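import Summits.KontsevichZagierPeriods.Zeta5Search.LaiSweepShard

/-!
# `κ₃` sweep certificate — shard file 019 of 127 (shards 133–139 of 889)

HONEST FRAMING. Systematic search; no irrationality claim unless certified. This file only checks,
by `decide +kernel`, shards 133–139 of the order-cell sweep of the `κ₃` point `(74, 2180, 444; δ74)`
(engine `LaiSweepEngine`, soundness `LaiSweepJump/Free/Eval/Shard/Kappa3`; a shard is `⟨regime, n,
p, q, p', q', Lo, Up⟩`: `n` cells from `p/q` to `p'/q'` with integer rate sums in `[Lo, Up]`, `K =
128`, `D = 2^40`). It draws NO conclusion: only the capstone `LaiKappa3SweepCert`, which needs all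
127 shard files, does. Kernel cost of this file ≈ 560 cells × 0.3 s.
-/

namespace Summit.KontsevichZagierPeriods.Zeta5Search.Sweep

set_option maxHeartbeats 100000000 in
/-- Shard 133: 80 cells of regime B from `14/285` to `19/377`.
[cite: Lai2024BallRivoal, §4 Lemma 4.3] -/
theorem shard133 :
    Shard.check 128 (2^40)
      ⟨true, 80, 14, 285, 19, 377, 140470423457735, 140721810532510⟩ = true := by
  decide +kernel

set_option maxHeartbeats 100000000 in
/-- Shard 134: 80 cells of regime B from `19/377` to `17/329`.
[cite: Lai2024BallRivoal, §4 Lemma 4.3] -/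
theorem shard134 :
    Shard.check 128 (2^40)
      ⟨true, 80, 19, 377, 17, 329, 136089381196012, 136320162935864⟩ = true := by
  decide +kernel

set_option maxHeartbeats 100000000 in
/-- Shard 135: 80 cells of regime B from `17/329` to `17/321`.
[cite: Lai2024BallRivoal, §4 Lemma 4.3] -/
theorem shard135 :
    Shard.check 128 (2^40)
      ⟨true, 80, 17, 329, 17, 321, 133710184916613, 133968832366339⟩ = true := by
  decide +kernel

set_option maxHeartbeats 100000000 in
/-- Shard 136: 80 cells of regime B from `17/321` to `11/203`.
[cite: Lai2024BallRivoal, §4 Lemma 4.3] -/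
theorem shard136 :
    Shard.check 128 (2^40)
      ⟨true, 80, 17, 321, 11, 203, 124726590861637, 124953080336263⟩ = true := by
  decide +kernel

set_option maxHeartbeats 100000000 in
/-- Shard 137: 80 cells of regime B from `11/203` to `17/307`.
[cite: Lai2024BallRivoal, §4 Lemma 4.3] -/
theorem shard137 :
    Shard.check 128 (2^40)
      ⟨true, 80, 11, 203, 17, 307, 117146767676440, 117356361873942⟩ = true := by
  decide +kernel

set_option maxHeartbeats 100000000 in
/-- Shard 138: 80 cells of regime B from `17/307` to `11/194`.
[cite: Lai2024BallRivoal, §4 Lemma 4.3] -/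
theorem shard138 :
    Shard.check 128 (2^40)
      ⟨true, 80, 17, 307, 11, 194, 128292389222531, 128571172307365⟩ = true := by
  decide +kernel

set_option maxHeartbeats 100000000 in
/-- Shard 139: 80 cells of regime B from `11/194` to `19/328`.
[cite: Lai2024BallRivoal, §4 Lemma 4.3] -/
theorem shard139 :
    Shard.check 128 (2^40)
      ⟨true, 80, 11, 194, 19, 328, 115431653450411, 115662346486167⟩ = true := by
  decide +kernel

/-- The checked shards of this file, in order. [folklore] -/
def shards019 : List (CheckedShard 128 (2^40)) :=
  [⟨_, shard133⟩, ⟨_, shard134⟩, ⟨_, shard135⟩, ⟨_, shard136⟩, ⟨_, shard137⟩,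
    ⟨_, shard138⟩, ⟨_, shard139⟩]

end Summit.KontsevichZagierPeriods.Zeta5Search.Sweep
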